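import Literature.IUT.HodgeTheaters.GlobalRealifiedFrobenioidsPrimes
import HarnessLib

/-!
# [IUTchII] Cor 4.5 (v) at the divisor-monoid model of the initial Θ-data: `Prime(D^⊩_gau(†D^⊢_≻)) ⥲ V`, its
# compatibility with `Prime(D^⊩_env(†D^⊢_≻)) ⥲ V` under the global formal evaluation isomorphism, and the
# `v`-components `Φ_{D^⊩_gau,v} ≅ ℝ_{≥0}·(…, j²·, …)` (proof-only companion of `GlobalGaussianRealifiedBridge.lean`)

S. Mochizuki, *Inter-universal Teichmüller theory II*, §4, kurims manuscript (Dec. 2020), Corollary 4.5 (v)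
pp. 133–134 [cite: Mochizuki2012, Cor 4.5 (v) p.133]: "a Frobenioid `D^⊩_env(†D^⊢_≻)` — namely, as a copy of the
Frobenioid `D^⊩(†D^⊢_≻)` of (ii) above, multiplied by a formal symbol `log^{†D^⊢_≻}(Θ)` … — isomorphic to the
Frobenioid `C^⊩_mod` of [IUTchI], Example 3.5, (i), equipped with a bijection `Prime(D^⊩_env(†D^⊢_≻)) ⥲ V` … and, for
each `v ∈ V`, an isomorphism of topological monoids `Φ_{D^⊩_env(†D^⊢_≻),v} ⥲ Ψ_env(†D^⊢_≻)^ℝ_v`"; "`D^⊩_gau(†D^⊢_≻) ⊆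
∏_{j∈F_l^⋇} D^⊩(†D^⊢_≻)_j` … whose divisor and rational function monoids are determined … by the «vector of ratios»
`(…, j²·, …)` … equipped with a bijection `Prime(D^⊩_gau(†D^⊢_≻)) ⥲ V` … and, for each `v ∈ V`, an isomorphism …
`Φ_{D^⊩_gau(†D^⊢_≻),v} ⥲ Ψ_gau(†D^⊢_≻)^ℝ_v` — where we write `Φ_{D^⊩_gau(†D^⊢_≻),v}` for the submonoid [isomorphic to `ℝ_{≥0}`]
of the divisor monoid of `D^⊩_gau(†D^⊢_≻)` associated to `v`"; "a global formal evaluation isomorphism of Frobenioids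
`D^⊩_env(†D^⊢_≻) ⥲ D^⊩_gau(†D^⊢_≻)` which is compatible, relative to the bijections and local isomorphisms of topological
monoids associated to these Frobenioids, with the local evaluation isomorphisms of (iv) above". Claim key
DISPUTED (D-0012); abc-iut cell, DAG node **IUTchII:Cor4.5(v)**, wave-4 seat abc-iut-w4-d005 (gen 3).
PROOF-ONLY (0 defs); nothing here asserts a disputed claim or takes a side on [IUTchIII] Cor. 3.12.

LEVEL (honest framing). The cell types the realified global Frobenioids of [IUTchI] Ex. 3.5 / [IUTchII] Cor. 4.5
(ii), (v) at the level of their DIVISOR MONOIDS in fixed coordinates (abc-iut-L5-t2 `InitialThetaData.PhiMod` /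
`PhiTht`, p405521; abc-iut-L6-t2 `weightedDiagonal` / `globalEvalIso` / `weightedDiagonalHom_local`, p404130, and the
model bridge `phiGau` / `thtToGau` / `rho_thtToGau`, p406619) — the [FrdI] Thm. 5.2 model form, in which a realified
global Frobenioid with trivial base is determined by its divisor monoid `⊕_{v∈V} ℝ_{≥0}·v`. Already in the tree at
that level: `D^⊩_env` as the copy `Φ_{C⊩_tht} = Φ_{C⊩_mod}·log(Θ)` with `Prime(Φ_{C⊩_tht}) ⥲ V_mod` (abc-iut-w4-d013
`primes_phiTht_bijective`, p413243); `D^⊩_gau` = the weighted diagonal `phiGau D` with the global formal evaluation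
isomorphism `thtToGau` and its compatibility `rho_thtToGau` with the local `ρ_w` (= "compatible … with the local
evaluation isomorphisms of (iv)", weights `j²` = Prop 4.1 (iv) / 4.3 (iv)); `Prime(Φ_{†C^⊩_LGP}) ⥲ V_mod` for the
re-embedded copy `phiLGP D = phiGau D` (abc-iut-w4-d013 `primesLGPEquiv`, `phiLGP_eq_phiGau`, p412468).

WHAT THIS FILE ADDS (the printed (v) clauses not yet literal for `phiGau` ITSELF):
* `isPrimary_thtToGau_logTht`, **`primes_phiGau_bijective`** — «a bijection `Prime(D^⊩_gau(†D^⊢_≻)) ⥲ V`»: the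
  explicit map `v ↦ [(1²·δ_v, 2²·δ_v, …)]` (the class of the weighted diagonal of `log^⊢_mod(p_v)·log(Θ)`) is a
  bijection `V_mod → Prime(Φ_{D^⊩_gau})`;
* **`primesCongr_thtToGau_logTht`** — «compatible, relative to the bijections»: the global formal evaluation
  isomorphism `thtToGau` carries the prime of `v` in `Φ_{D^⊩_env} = Φ_{C⊩_tht}` to the prime of `v` in `Φ_{D^⊩_gau}`
  (its transport `Prime(thtToGau)` intertwines the two `Prime(−) ⥲ V` bijections: `primes_thtToGau_compatible`);
* `thtToGau_smul_logTht_apply`, **`mem_phiGau_supportedAt_iff`** — the `v`-COMPONENT «`Φ_{D^⊩_gau(†D^⊢_≻),v}` … [isomorphic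
  to `ℝ_{≥0}`]»: the elements of `Φ_{D^⊩_gau}` supported at `v` are exactly the weighted diagonals
  `(…, (j²·c)·δ_v, …)`, `c ∈ ℝ_{≥0}`, i.e. the ray `ℝ_{≥0}·(…, j²·, …)` over the `v`-component `Φ_{C⊩_mod,v} = ℝ_{≥0}·δ_v`
  (abc-iut-L5-t2 `PhiModAt v`) — the shape of `Ψ_gau(†D^⊢_≻)^ℝ_v` (Prop 4.1 (iv) / 4.3 (iv): the realification of
  `Ψ_gau,v` modulo units is the ray `ℝ_{≥0}·(…, j²·log(p_v), …)`, abc-iut-L6-t2 `ConstantMonoidDatum.evalHom_ray`,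
  `gaussianMonoid_snd_ray`), with the local reading `rho_thtToGau` supplying the normalisation `ρ_w`;
  `thtToGau_supportedAt` — `thtToGau` maps `Φ_{D^⊩_env,v}` INTO `Φ_{D^⊩_gau,v}` («compatible, relative to the … local
  isomorphisms»).
The Frobenioid-categorical packaging ([FrdI] Thm. 5.2 model categories of these divisor monoids, layer L1) and the
slot `Cor45Statements.globalRealified` (a `Prop` field, abc-iut-L6-t2) are not touched.
-/

noncomputable section

namespace Literature.IUT.HodgeArakelov

open Literature.IUT.HodgeTheaters Literature.AlgebraicGeometry.Frobenioids Literature.IUT.LogThetaLattice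
open scoped NNReal Literature.AlgebraicGeometry.Frobenioids

universe u v w

variable {F : Type u} {K : Type v} {Fbar : Type w} [Field F] [NumberField F] [Field K]
  [NumberField K] [Algebra F K] [Field Fbar] [Algebra F Fbar] [Algebra K Fbar]
  {E : WeierstrassCurve F} [E.IsElliptic] {l : ℕ} {P : BadPlacePredicates K}
  (D : InitialThetaData F K Fbar E l P)

/-! ### 1. `Prime(D^⊩_gau(†D^⊢_≻)) ⥲ V` -/

/-- **IUTchII:Cor4.5(v)** (kurims p.134) The weighted diagonal `(1²·δ_v, 2²·δ_v, …)` of the generator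
`log^⊢_mod(p_v)·log(Θ)` — the image of the prime generator of `v` under the global formal evaluation isomorphism — is a
PRIMARY element ([FrdI] §0) of the divisor monoid `Φ_{D^⊩_gau}` (transport of abc-iut-w4-d013's `isPrimary_logMod`
along `thtToGau`). [cite: Mochizuki2012, Cor 4.5 (v) p.134] -/
theorem isPrimary_thtToGau_logTht (v : Val (fieldOfModuli E)) :
    IsPrimary (Multiplicative.ofAdd (thtToGau D (D.modToTht (D.logMod v)))) :=
  (D.isPrimary_logMod v).map_mulEquiv (AddEquiv.toMultiplicative (thtToGau D))

/-- **IUTchII:Cor4.5(v)** (kurims p.134) «compatible, relative to the bijections»: the transport `Prime(thtToGau)` of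
the global formal evaluation isomorphism sends the prime of `v` in `Φ_{D^⊩_env} = Φ_{C⊩_tht}` (the class of
`log^⊢_mod(p_v)·log(Θ)`) to the class of its weighted diagonal in `Φ_{D^⊩_gau}`. [cite: Mochizuki2012, Cor 4.5 (v) p.134] -/
theorem primesCongr_thtToGau_logTht (v : Val (fieldOfModuli E)) :
    Primes.congr (AddEquiv.toMultiplicative (thtToGau D))
        (Quotient.mk (primarySetoid _) ⟨Multiplicative.ofAdd (D.modToTht (D.logMod v)), D.isPrimary_logMod v⟩) =
      Quotient.mk (primarySetoid _)
        ⟨Multiplicative.ofAdd (thtToGau D (D.modToTht (D.logMod v))), isPrimary_thtToGau_logTht D v⟩ :=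
  Primes.congr_mk _ _ _ _

/-- **IUTchII:Cor4.5(v)** (kurims p.134) **«a bijection `Prime(D^⊩_gau(†D^⊢_≻)) ⥲ V`»** at the divisor-monoid model:
`v ↦ [(1²·δ_v, 2²·δ_v, …, (l⋆)²·δ_v)]` is a bijection from `V_mod` onto the primes of the divisor monoid `Φ_{D^⊩_gau}`
of the global realified Gaussian Frobenioid (abc-iut-L6-t2's `phiGau`) — the composite of abc-iut-w4-d013's
`Prime(Φ_{C⊩_tht}) ⥲ V_mod` with the transport of primes along the global formal evaluation isomorphism (`V̲ ⥲ V_mod`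
is [IUTchI] Def 3.1 (e), not re-typed). [cite: Mochizuki2012, Cor 4.5 (v) p.134] -/
theorem primes_phiGau_bijective :
    Function.Bijective fun v : Val (fieldOfModuli E) =>
      (Quotient.mk (primarySetoid _)
        ⟨Multiplicative.ofAdd (thtToGau D (D.modToTht (D.logMod v))), isPrimary_thtToGau_logTht D v⟩ :
        Primes (Multiplicative (phiGau D))) := by
  have h : (fun v : Val (fieldOfModuli E) =>
      (Quotient.mk (primarySetoid _)
        ⟨Multiplicative.ofAdd (thtToGau D (D.modToTht (D.logMod v))), isPrimary_thtToGau_logTht D v⟩ :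
        Primes (Multiplicative (phiGau D)))) =
      Primes.congr (AddEquiv.toMultiplicative (thtToGau D)) ∘ fun v : Val (fieldOfModuli E) =>
        (Quotient.mk (primarySetoid _)
          ⟨Multiplicative.ofAdd (D.modToTht (D.logMod v)), D.isPrimary_logMod v⟩ :
          Primes (Multiplicative D.PhiTht)) := by
    funext v
    exact (primesCongr_thtToGau_logTht D v).symm
  rw [h]
  exact (Primes.congr _).bijective.comp D.primes_phiTht_bijective

/-- **IUTchII:Cor4.5(v)** (kurims p.134) The two printed bijections `Prime(D^⊩_env) ⥲ V`, `Prime(D^⊩_gau) ⥲ V` CORRESPOND under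
the global formal evaluation isomorphism: for every prime `𝔭` of `Φ_{D^⊩_env}` with place `v`, its transport along
`thtToGau` is the prime of `Φ_{D^⊩_gau}` with the same place `v`. [cite: Mochizuki2012, Cor 4.5 (v) p.134] -/
theorem primes_thtToGau_compatible (𝔭 : Primes (Multiplicative D.PhiTht)) :
    ∃ v : Val (fieldOfModuli E),
      𝔭 = Quotient.mk (primarySetoid _) ⟨Multiplicative.ofAdd (D.modToTht (D.logMod v)), D.isPrimary_logMod v⟩ ∧
      Primes.congr (AddEquiv.toMultiplicative (thtToGau D)) 𝔭 =
        Quotient.mk (primarySetoid _)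
          ⟨Multiplicative.ofAdd (thtToGau D (D.modToTht (D.logMod v))), isPrimary_thtToGau_logTht D v⟩ := by
  obtain ⟨v, rfl⟩ := D.primes_phiTht_bijective.2 𝔭
  exact ⟨v, rfl, primesCongr_thtToGau_logTht D v⟩

/-! ### 2. The `v`-components `Φ_{D^⊩_gau(†D^⊢_≻),v}` -/

/-- **IUTchII:Cor4.5(v)** (kurims p.134) The global formal evaluation isomorphism on the `v`-ray of `Φ_{D^⊩_env}`: the `j`-th
component of `thtToGau (c·log^⊢_mod(p_v)·log(Θ))` is `(j²·c)·δ_v` — the «vector of ratios» `(…, j²·, …)` applied to the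
`v`-coordinate. [cite: Mochizuki2012, Cor 4.5 (v) p.134] -/
theorem thtToGau_smul_logTht_apply (v : Val (fieldOfModuli E)) (c : ℝ≥0) (j : Fin (lStar l)) :
    ((thtToGau D (D.modToTht (c • D.logMod v)) : phiGau D) : Fin (lStar l) → D.PhiMod) j =
      Finsupp.single v ((((j.val + 1) ^ 2 : ℕ) : ℝ≥0) * c) := by
  rw [thtToGau_apply]
  change sqWeight (lStar l) j • (c • Finsupp.single v (1 : ℝ≥0)) = _
  rw [sqWeight, Finsupp.smul_single, Finsupp.smul_single, smul_eq_mul, mul_one, nsmul_eq_mul]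

/-- **IUTchII:Cor4.5(v)** (kurims p.134) The ray `ℝ_{≥0}·log^⊢_mod(p_v)` IS the `v`-component `Φ_{C⊩_mod,v}` of abc-iut-L5-t2
(`PhiModAt v`: families vanishing off `v`). [cite: Mochizuki2012, Cor 4.5 (v) p.134] -/
theorem mem_phiModAt_iff (v : Val (fieldOfModuli E)) (φ : D.PhiMod) :
    φ ∈ D.PhiModAt v ↔ ∃ c : ℝ≥0, φ = c • D.logMod v := by
  constructor
  · intro h
    refine ⟨φ v, Finsupp.ext fun v' => ?_⟩
    change φ v' = (φ v • Finsupp.single v (1 : ℝ≥0)) v'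
    rw [Finsupp.smul_single, smul_eq_mul, mul_one]
    by_cases hv : v' = v
    · subst hv; rw [Finsupp.single_eq_same]
    · rw [Finsupp.single_eq_of_ne hv]; exact h v' hv
  · rintro ⟨c, rfl⟩ v' hv'
    change (c • Finsupp.single v (1 : ℝ≥0)) v' = 0
    rw [Finsupp.smul_single, Finsupp.single_eq_of_ne hv']

/-- **IUTchII:Cor4.5(v)** (kurims p.134) **«`Φ_{D^⊩_gau(†D^⊢_≻),v}` … the submonoid [isomorphic to `ℝ_{≥0}`] of the divisor monoid of
`D^⊩_gau(†D^⊢_≻)` associated to `v`»** at the divisor-monoid model: an element of the weighted diagonal `Φ_{D^⊩_gau}` is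
supported at `v` (every label-`j` component lies in `Φ_{C⊩_mod,v}`) iff it is `(…, (j²·c)·δ_v, …)` for a (unique, by the
`j = 1` component) `c ∈ ℝ_{≥0}` — i.e. `Φ_{D^⊩_gau,v}` is the ray `ℝ_{≥0}·(1², 2², …, (l⋆)²)·δ_v`, the shape of
`Ψ_gau(†D^⊢_≻)^ℝ_v = ℝ_{≥0}·(…, j²·log(p_v), …)` (Prop 4.1 (iv) / 4.3 (iv); abc-iut-L6-t2 `ConstantMonoidDatum.evalHom_ray`).
[cite: Mochizuki2012, Cor 4.5 (v) p.134] -/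
theorem mem_phiGau_supportedAt_iff (v : Val (fieldOfModuli E)) (x : phiGau D) :
    (∀ j : Fin (lStar l), ((x : Fin (lStar l) → D.PhiMod) j) ∈ D.PhiModAt v) ↔
      ∃ c : ℝ≥0, ∀ j : Fin (lStar l),
        (x : Fin (lStar l) → D.PhiMod) j = Finsupp.single v ((((j.val + 1) ^ 2 : ℕ) : ℝ≥0) * c) := by
  have hl : 0 < lStar l := lStar_pos_of_initialThetaData D
  obtain ⟨φ, hφ⟩ := (mem_weightedDiagonal_iff D.PhiMod (lStar l) (x : Fin (lStar l) → D.PhiMod)).1 x.2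
  constructor
  · intro h
    -- the `j = 1` component is `1²·φ = φ`, hence `φ ∈ Φ_{C⊩_mod,v}`, `φ = c·δ_v`
    have h0 : (x : Fin (lStar l) → D.PhiMod) ⟨0, hl⟩ = φ := by
      rw [hφ ⟨0, hl⟩]; simp
    obtain ⟨c, hc⟩ := (mem_phiModAt_iff D v φ).1 (h0 ▸ h ⟨0, hl⟩)
    refine ⟨c, fun j => ?_⟩
    rw [hφ j, hc]
    change ((j.val + 1) ^ 2 : ℕ) • (c • Finsupp.single v (1 : ℝ≥0)) = _
    rw [Finsupp.smul_single, Finsupp.smul_single, smul_eq_mul, mul_one, nsmul_eq_mul]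
  · rintro ⟨c, hc⟩ j v' hv'
    rw [hc j, Finsupp.single_eq_of_ne hv']

/-- **IUTchII:Cor4.5(v)** (kurims p.134) «compatible, relative to the … local isomorphisms»: the global formal evaluation
isomorphism carries the `v`-component `Φ_{D^⊩_env,v} = ℝ_{≥0}·log^⊢_mod(p_v)·log(Θ)` INTO the `v`-component `Φ_{D^⊩_gau,v}` (every
label-`j` component of the image is supported at `v`), with `j`-th coordinate `j²·c` — the local evaluation
isomorphism `log(p_v)·log(Θ) ↦ (…, j²·log(p_v), …)` of (iv) read at divisor level (cf. `rho_thtToGau` for the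
normalisation by `ρ_w`). [cite: Mochizuki2012, Cor 4.5 (v) p.134] -/
theorem thtToGau_supportedAt (v : Val (fieldOfModuli E)) {φ : D.PhiMod} (hφ : φ ∈ D.PhiModAt v)
    (j : Fin (lStar l)) :
    ((thtToGau D (D.modToTht φ) : phiGau D) : Fin (lStar l) → D.PhiMod) j ∈ D.PhiModAt v := by
  obtain ⟨c, rfl⟩ := (mem_phiModAt_iff D v φ).1 hφ
  intro v' hv'
  rw [thtToGau_smul_logTht_apply, Finsupp.single_eq_of_ne hv']

/-- **IUTchII:Cor4.5(v)** (kurims p.134) … and ONTO it: every element of `Φ_{D^⊩_gau,v}` is the image of a (unique) element of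
`Φ_{D^⊩_env,v}` — so the restriction `Φ_{D^⊩_env,v} ⥲ Φ_{D^⊩_gau,v}` of the global formal evaluation isomorphism is a bijection
of the two `v`-components [each isomorphic to `ℝ_{≥0}`]. [cite: Mochizuki2012, Cor 4.5 (v) p.134] -/
theorem thtToGau_supportedAt_surjective (v : Val (fieldOfModuli E)) (x : phiGau D)
    (hx : ∀ j : Fin (lStar l), ((x : Fin (lStar l) → D.PhiMod) j) ∈ D.PhiModAt v) :
    ∃! φ : D.PhiMod, φ ∈ D.PhiModAt v ∧ thtToGau D (D.modToTht φ) = x := by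
  obtain ⟨c, hc⟩ := (mem_phiGau_supportedAt_iff D v x).1 hx
  have hx' : thtToGau D (D.modToTht (c • D.logMod v)) = x := by
    apply Subtype.ext
    funext j
    rw [thtToGau_smul_logTht_apply, hc j]
  refine ⟨c • D.logMod v, ⟨(mem_phiModAt_iff D v _).2 ⟨c, rfl⟩, hx'⟩, ?_⟩
  rintro φ ⟨-, hφx⟩
  exact D.modToTht.injective ((thtToGau D).injective (hφx.trans hx'.symm))

end Literature.IUT.HodgeArakelov

end
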